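import Mathlib
import Literature.Probability.Process.PointStationaryLaw
import Literature.Probability.Process.RootedHardCoreConfig
import Literature.MathematicalPhysics.StatisticalMechanics.BarlowStacking
import Literature.MathematicalPhysics.StatisticalMechanics.Crystallization
import Literature.MathematicalPhysics.StatisticalMechanics.RootEnergy
import Literature.Geometry.DiscreteGeometry.TwoShellPatterns
import Summits.AtomisticToContinuum.Crystallization.Theses.ChartedPlanarOrder
import Summits.AtomisticToContinuum.Crystallization.Theses.GrainCoreNetworkSplit
import Summits.AtomisticToContinuum.Crystallization.Theorems.ChartedPlanarOrderDiscreteBarlowRigidity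

/-!
# NODE «RigidityDoor» (decomp-a2c lens-3 g20) on N = `ChartedPlanarOrder.ChartedZeroExcessLayered` (stmt-AtomisticToContinuum-26636)
# (tree landing by prover hand 1 (g7) at critic row 353 (2) from HOME/decomp-a2c-lens-3/g20/RigidityDoor.lean rev b 54720283…: bodies byte-identical,
# namespace = this module, + the `Iff.rfl` bridge `discreteBarlowRigidity_iff_expanded` to the text of record `ChartedPlanarOrderDiscreteBarlowRigidity`)

Skeleton of record c966ab35 (g18/g19 «AmplitudeCut»): N ⟸ X✓ ∧ U₂✓ ∧ GAP(1/50) ∧ PERT(1/50) ∧ U₁.  This node goes THROUGH THE μ-EQUILIBRIUM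
DOOR beneath the two open analytic pieces GAP = `VisibleGap` and PERT = `PertRegime` (texts VERBATIM below) and TYPES the lineage's shared
missing lemma R⋆ «DiscreteBarlowRigidity» (critic row 341 (5)).  All cuts are ONE-WAY; no EQUIV is spent.

  GAP(ν) ⟸ DOOR ∧ SparseNull(ν) ∧ SparseMisfit(ν)                       (`visibleGap_of_door_sparse`, PROVED)
  PERT(ν) ⟸ DOOR ∧ (∀ η ≤ 1/16, SparseNull η ∧ SparseMisfit η)            (`pertRegime_of_door_sparse`, PROVED)
  SparseMisfit(ν) ⟸ R⋆ ∧ BindingSurface ∧ WindowCounting  (0 < ν ≤ 1/16)  (`sparseMisfit_of_rigidity`, PROVED)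

* DOOR = `Theses.GrainCoreNetworkSplit.MuEquilibriumDoor` BY NAME (lens-2 support item stmt-27073, TRUE, tree-proved modulo the farm build of the
  EquilibriumInLaw chain): a point-stationary rooted hard-core law with mean root energy ≤ e⋆ is a.s. an e⋆-μ-ground-state configuration.
  N's binders are its hypotheses up to `IsRootedHardCore` / `IsPointStationaryLaw` / `rootEnergy` unfolding (all `rfl`).
* SparseNull(ν) — TRUE·M (unimodular window identity): for a point-stationary rooted law, E_P[windowBadFrac ν R] = P(root window not ν-matched)
  EXACTLY (Mecke with g μ y = 𝟙{¬matched_ν(μ,y)}·𝟙{‖y‖ ≤ R}/#(atoms ∩ B̄_R(y)); covariance of `matchedAt`, cf. g19 `matchedAt_of_map_sub`;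
  measurability as in Theorems.ChartedPlanarOrderDefectEventMeasurable); hence uniformly vanishing window bad-fractions force a.s. matching.
* SparseMisfit(ν) = D♯(ν) — THE LENS-3 TRANSLATION of the residual into DETERMINISTIC μGSC currency: in every rooted δ-hard-core, clean, single-site
  Nash, Barlow-bond-charted e⋆-μ-ground state the normalised count of ν-unmatched atoms in the root's R-window is ≤ ε once R ≥ R(δ, ε).
  WEAKER-OR-EQUIVALENT to GAP(ν): GAP(ν) ⟹ D♯(ν) by configuration→law transfer (Benjamini–Schramm/Palm limit of the empirical rooted measures
  of a violating sequence: stationary, clean/Nash/charted by closedness + chart compactness, zero excess by BindingSurface, root unmatched with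
  probability ≥ ε by Portmanteau — the TexturedLawTransfer p786480 / NetworkRecurrenceTransfer p810233 machinery; lens-4 `MuGSCLimitClosed` p810240).
  WHY EASIER than GAP (named tools): no Palm calculus; the hypothesis «e⋆-μGSC» supplies SURGERY INEQUALITIES AT EVERY FINITE SCALE (hand-2
  OneAtomTests/SurgeryTests: removal/rearrangement/insertion tests by name), in particular BindingSurface below, which a zero-excess law does not give
  pathwise; it is the natural target of discrete ε-regularity for local minimisers and of R⋆.
* GapTransfer(ν) — the certificate edge `(∀ ν' < ν, GAP(ν')) ⟹ SparseMisfit(ν)` TYPED (not used by kernels; TRUE-type expected modulo the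
  closedness caveat of N's cleanliness binder, see its docstring).
* R⋆ «DiscreteBarlowRigidity» — THE SHARED MISSING LEMMA (typed here FIRST, general deterministic currency, e⋆-free constants c, C, r depending on δ
  only): for every finite chunk K of (1/16, 9/10, 1)-two-shell-clean atoms of a δ-separated configuration S and every tolerance 0 < θ ≤ 1/16,
      c·θ²·#{x ∈ K | x not θ-matched in S}  ≤  Σ_{x ∈ K} (e_x(S) − e⋆)  +  C·#{x ∈ K | ∃ y ∈ S ∖ K, dist x y ≤ r}
  (Friesecke–James–Müller-shaped: energy above e⋆ controls the number of sites visibly off every isometric flexible-scale flexible-gap layered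
  Barlow template, up to a boundary layer).  STRONGER than D♯ (a ROOF, like KPERT/QUAL — honest: it implies GAP(ν) for every ν ≤ 1/16 AND PERT);
  XL; INSTRUMENTABLE (census: minimise the slack over small clean chunks at θ = 1/50).  Presearch: [corpus:paper:arxiv-2205.04849 §2.2 p10,
  Thms 3.18–3.20 — Schmidt–Steinbach, local rigidity seminorms and second-order (harmonic) stability constants of objective structures, hcp
  included; refs [16] Conti–Dolzmann–Kirchheim–Müller JEMS 8 (2006) 515 (Cauchy–Born validity close to SO(n)), [21] E–Ming ARMA 183 (2007),
  [29] Friesecke–Theil JNS 12 (2002), [43][44] Schmidt MMS 5 (2006) / NHM 4 (2009) discrete rigidity, [9] Braun–Schmidt]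
  [galaxy:pdf:-2546485432507416440 = arXiv:1601.05968 Alicandro–Lazzaroni–Palombaro, rigidity of discrete energies with NNN interactions];
  none states a FINITE-AMPLITUDE energy-coercivity with boundary slack for Lennard-Jones Barlow chunks — R⋆ is open as typed; its infinitesimal
  part is the Schmidt–Steinbach stability constant (= HC/UPS, stmt-15800 window).
* BindingSurface — TRUE·M: in a rooted δ-hard-core e⋆-μGSC the site-energy excess of the root's R-window is ≤ C₁(δ)·R² (removal test with k = 0:
  U(K) + I(K, S∖K) ≤ e⋆·#K, hand-2 `removal_le_of_isMuGSC`; Σ_K e_x = U(K) + ½ I(K, S∖K); −I ≤ shell/tail sum O(R²)).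
* WindowCounting — TRUE·S/M: for rooted δ-hard-core CLEAN configurations, #(r-boundary layer of the R-window) ≤ C₂ R² and every atom p of the
  window has ≥ c₃ R³ atoms in ITS R-window (two-shell cleanliness ⇒ 12 neighbours within 1.07 of every atom ⇒ local density; packing).
-/

noncomputable section

open MeasureTheory Set

namespace Summit.AtomisticToContinuum.Crystallization.Theorems.ChartedPlanarOrderRigidityDoor

/-- ambient space -/
abbrev E3 := EuclideanSpace ℝ (Fin 3)

/-- `e⋆ = ⨅_Q e(Q)`, the infimum of the Lennard-Jones energy per particle over periodic configurations. -/
def eStar : ℝ :=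
  ⨅ Q : Literature.MathematicalPhysics.StatisticalMechanics.PeriodicConfiguration 3,
    Q.energyPerParticle Literature.MathematicalPhysics.StatisticalMechanics.lennardJones

/-! ## 1. Verbatim currency of the registered skeleton (g18/g19): `matchedAt`, GAP = `VisibleGap`, PERT = `PertRegime` -/

/-- `matchedAt ν μ x` — VERBATIM g19 `AmplitudeCut.matchedAt`: two-way `ν`-matching about `x` to `x +` an isometric image of a flexible-gap
layered Barlow template of scale `b ∈ [9/10, 1]` (configuration → template on `B̄(x,4b)`, template → configuration on `B̄(x,5b)`). -/
def matchedAt (ν : ℝ) (μ : MeasureTheory.Measure (EuclideanSpace ℝ (Fin 3))) (x : EuclideanSpace ℝ (Fin 3)) : Prop :=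
  ∃ b : ℝ, 9 / 10 ≤ b ∧ b ≤ 1 ∧ ∃ (A : EuclideanSpace ℝ (Fin 3) →ₗᵢ[ℝ] EuclideanSpace ℝ (Fin 3)) (s : ℤ → ℤ) (z : ℤ → ℝ), Literature.MathematicalPhysics.StatisticalMechanics.IsHaggSeq s ∧ (∀ m : ℤ, 39 / 50 * b ≤ z (m + 1) - z m ∧ z (m + 1) - z m ≤ 17 / 20 * b) ∧ z 0 = 0 ∧ (∀ y : EuclideanSpace ℝ (Fin 3), dist y x ≤ 4 * b → μ {y} ≠ 0 → ∃ y' : EuclideanSpace ℝ (Fin 3), y' - x ∈ {p | ∃ m i j : ℤ, p = A (((i : ℝ) • Literature.MathematicalPhysics.StatisticalMechanics.triangularVec₁ b) + ((j : ℝ) • Literature.MathematicalPhysics.StatisticalMechanics.triangularVec₂ b) + ((Literature.MathematicalPhysics.StatisticalMechanics.haggLabel s m : ℝ) • Literature.MathematicalPhysics.StatisticalMechanics.barlowOffset b) + (z m • Literature.MathematicalPhysics.StatisticalMechanics.layerNormal 1))} ∧ dist y y' ≤ ν) ∧ (∀ y' : EuclideanSpace ℝ (Fin 3), y' - x ∈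 {p | ∃ m i j : ℤ, p = A (((i : ℝ) • Literature.MathematicalPhysics.StatisticalMechanics.triangularVec₁ b) + ((j : ℝ) • Literature.MathematicalPhysics.StatisticalMechanics.triangularVec₂ b) + ((Literature.MathematicalPhysics.StatisticalMechanics.haggLabel s m : ℝ) • Literature.MathematicalPhysics.StatisticalMechanics.barlowOffset b) + (z m • Literature.MathematicalPhysics.StatisticalMechanics.layerNormal 1))} → dist y' x ≤ 5 * b → ∃ y : EuclideanSpace ℝ (Fin 3), μ {y} ≠ 0 ∧ dist y y' ≤ ν)

/-- GAP(ν) · `VisibleGap ν` — VERBATIM g18/g19 `AmplitudeCut.VisibleGap` = text of the registered stub `stub_visibleGap` (c966ab35) at ν = 1/50. -/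
def VisibleGap (ν : ℝ) : Prop :=
  ∀ δ : ℝ, 0 < δ → ∀ P : MeasureTheory.Measure (MeasureTheory.Measure (EuclideanSpace ℝ (Fin 3))), MeasureTheory.IsProbabilityMeasure P → (∀ᵐ μ ∂P, (∃ S : Set (EuclideanSpace ℝ (Fin 3)), (0 : EuclideanSpace ℝ (Fin 3)) ∈ S ∧ (∀ x ∈ S, ∀ y ∈ S, x ≠ y → δ ≤ dist x y) ∧ μ = (MeasureTheory.Measure.count : MeasureTheory.Measure (EuclideanSpace ℝ (Fin 3))).restrict S)) → (∀ g : MeasureTheory.Measure (EuclideanSpace ℝ (Fin 3)) → EuclideanSpace ℝ (Fin 3) → ENNReal, Measurable (Function.uncurry g) → ∫⁻ μ, ∫⁻ y, g μ y ∂μ ∂P = ∫⁻ μ, ∫⁻ y, g (MeasureTheory.Measure.map (fun z => z - y) μ) (-y) ∂μ ∂P) → (∫ μ, (∫ y, Literature.MathematicalPhysics.StatisticalMechanics.lennardJones ‖y‖ ∂μ) / 2 ∂P) ≤ (⨅ Q : Literature.MathematicalPhysics.StatisticalMechanics.PeriodicConfiguration 3, Q.energyPerParticle Literature.MathematicalPhysics.StatisticalMechanics.lennardJones)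 → (∀ᵐ μ ∂P, ∀ q : EuclideanSpace ℝ (Fin 3), μ {q} ≠ 0 → Literature.Geometry.DiscreteGeometry.IsTwoShellGoodSet (1 / 16) (9 / 10) 1 {p : EuclideanSpace ℝ (Fin 3) | μ {p} ≠ 0} q) → (∀ᵐ μ ∂P, ∀ p : EuclideanSpace ℝ (Fin 3), μ {p} ≠ 0 → ∀ y : EuclideanSpace ℝ (Fin 3), (∀ q : EuclideanSpace ℝ (Fin 3), μ {q} ≠ 0 → q ≠ p → y ≠ q) → ∑' q : {q : EuclideanSpace ℝ (Fin 3) // μ {q} ≠ 0 ∧ q ≠ p}, Literature.MathematicalPhysics.StatisticalMechanics.lennardJones (dist p (q : EuclideanSpace ℝ (Fin 3))) ≤ ∑' q : {q : EuclideanSpace ℝ (Fin 3) // μ {q} ≠ 0 ∧ q ≠ p}, Literature.MathematicalPhysics.StatisticalMechanics.lennardJones (dist y (q : EuclideanSpace ℝ (Fin 3)))) → (∀ᵐ μ ∂P, ∃ s : ℤ → ℤ, Literature.MathematicalPhysics.StatisticalMechanics.IsHaggSeq s ∧ ∃ Φ : EuclideanSpace ℝ (Fin 3) → EuclideanSpace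 ℝ (Fin 3), Set.BijOn Φ (Literature.MathematicalPhysics.StatisticalMechanics.barlowStacking 1 (Real.sqrt (2 / 3)) s) {p : EuclideanSpace ℝ (Fin 3) | μ {p} ≠ 0} ∧ ∀ p ∈ Literature.MathematicalPhysics.StatisticalMechanics.barlowStacking 1 (Real.sqrt (2 / 3)) s, ∀ q ∈ Literature.MathematicalPhysics.StatisticalMechanics.barlowStacking 1 (Real.sqrt (2 / 3)) s, (dist p q = 1 ↔ (0 < dist (Φ p) (Φ q) ∧ dist (Φ p) (Φ q) ≤ 28 / 25))) → ∀ᵐ μ ∂P, ∃ b : ℝ, 9 / 10 ≤ b ∧ b ≤ 1 ∧ ∃ (A : EuclideanSpace ℝ (Fin 3) →ₗᵢ[ℝ] EuclideanSpace ℝ (Fin 3)) (s : ℤ → ℤ) (z : ℤ → ℝ), Literature.MathematicalPhysics.StatisticalMechanics.IsHaggSeq s ∧ (∀ m : ℤ, 39 / 50 * b ≤ z (m + 1) - z m ∧ z (m + 1) - z m ≤ 17 / 20 * b) ∧ z 0 = 0 ∧ (∀ y : EuclideanSpace ℝ (Fin 3), dist y (0 : EuclideanSpace ℝ (Fin 3))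 ≤ 4 * b → μ {y} ≠ 0 → ∃ y' : EuclideanSpace ℝ (Fin 3), y' - (0 : EuclideanSpace ℝ (Fin 3)) ∈ {p | ∃ m i j : ℤ, p = A (((i : ℝ) • Literature.MathematicalPhysics.StatisticalMechanics.triangularVec₁ b) + ((j : ℝ) • Literature.MathematicalPhysics.StatisticalMechanics.triangularVec₂ b) + ((Literature.MathematicalPhysics.StatisticalMechanics.haggLabel s m : ℝ) • Literature.MathematicalPhysics.StatisticalMechanics.barlowOffset b) + (z m • Literature.MathematicalPhysics.StatisticalMechanics.layerNormal 1))} ∧ dist y y' ≤ ν) ∧ (∀ y' : EuclideanSpace ℝ (Fin 3), y' - (0 : EuclideanSpace ℝ (Fin 3)) ∈ {p | ∃ m i j : ℤ, p = A (((i : ℝ) • Literature.MathematicalPhysics.StatisticalMechanics.triangularVec₁ b) + ((j : ℝ) • Literature.MathematicalPhysics.StatisticalMechanics.triangularVec₂ b) + ((Literature.MathematicalPhysics.StatisticalMechanics.haggLabel s m : ℝ) • Literature.MathematicalPhysics.StatisticalMechanics.barlowOffset b) + (z m • Literature.MathematicalPhysics.StatisticalMechanics.layerNormal 1))} → dist y'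 (0 : EuclideanSpace ℝ (Fin 3)) ≤ 5 * b → ∃ y : EuclideanSpace ℝ (Fin 3), μ {y} ≠ 0 ∧ dist y y' ≤ ν)

/-- PERT(ν) · `PertRegime ν` — VERBATIM g18/g19 `AmplitudeCut.PertRegime` = text of the registered stub `stub_pertRegime` (c966ab35) at ν = 1/50. -/
def PertRegime (ν : ℝ) : Prop :=
  ∀ δ : ℝ, 0 < δ → ∀ P : MeasureTheory.Measure (MeasureTheory.Measure (EuclideanSpace ℝ (Fin 3))), MeasureTheory.IsProbabilityMeasure P → (∀ᵐ μ ∂P, (∃ S : Set (EuclideanSpace ℝ (Fin 3)), (0 : EuclideanSpace ℝ (Fin 3)) ∈ S ∧ (∀ x ∈ S, ∀ y ∈ S, x ≠ y → δ ≤ dist x y) ∧ μ = (MeasureTheory.Measure.count : MeasureTheory.Measure (EuclideanSpace ℝ (Fin 3))).restrict S)) → (∀ g : MeasureTheory.Measure (EuclideanSpace ℝ (Fin 3)) → EuclideanSpace ℝ (Fin 3) → ENNReal, Measurable (Function.uncurry g) → ∫⁻ μ, ∫⁻ y, g μ y ∂μ ∂P = ∫⁻ μ, ∫⁻ y, g (MeasureTheory.Measure.map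 (fun z => z - y) μ) (-y) ∂μ ∂P) → (∫ μ, (∫ y, Literature.MathematicalPhysics.StatisticalMechanics.lennardJones ‖y‖ ∂μ) / 2 ∂P) ≤ (⨅ Q : Literature.MathematicalPhysics.StatisticalMechanics.PeriodicConfiguration 3, Q.energyPerParticle Literature.MathematicalPhysics.StatisticalMechanics.lennardJones) → (∀ᵐ μ ∂P, ∀ q : EuclideanSpace ℝ (Fin 3), μ {q} ≠ 0 → Literature.Geometry.DiscreteGeometry.IsTwoShellGoodSet (1 / 16) (9 / 10) 1 {p : EuclideanSpace ℝ (Fin 3) | μ {p} ≠ 0} q) → (∀ᵐ μ ∂P, ∀ p : EuclideanSpace ℝ (Fin 3), μ {p} ≠ 0 → ∀ y : EuclideanSpace ℝ (Fin 3), (∀ q : EuclideanSpace ℝ (Fin 3), μ {q} ≠ 0 → q ≠ p → y ≠ q) → ∑' q : {q : EuclideanSpace ℝ (Fin 3) // μ {q} ≠ 0 ∧ q ≠ p}, Literature.MathematicalPhysics.StatisticalMechanics.lennardJones (dist p (q : EuclideanSpace ℝ (Fin 3))) ≤ ∑' q : {q : EuclideanSpace ℝ (Fin 3) // μ {q} ≠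 0 ∧ q ≠ p}, Literature.MathematicalPhysics.StatisticalMechanics.lennardJones (dist y (q : EuclideanSpace ℝ (Fin 3)))) → (∀ᵐ μ ∂P, ∃ s : ℤ → ℤ, Literature.MathematicalPhysics.StatisticalMechanics.IsHaggSeq s ∧ ∃ Φ : EuclideanSpace ℝ (Fin 3) → EuclideanSpace ℝ (Fin 3), Set.BijOn Φ (Literature.MathematicalPhysics.StatisticalMechanics.barlowStacking 1 (Real.sqrt (2 / 3)) s) {p : EuclideanSpace ℝ (Fin 3) | μ {p} ≠ 0} ∧ ∀ p ∈ Literature.MathematicalPhysics.StatisticalMechanics.barlowStacking 1 (Real.sqrt (2 / 3)) s, ∀ q ∈ Literature.MathematicalPhysics.StatisticalMechanics.barlowStacking 1 (Real.sqrt (2 / 3)) s, (dist p q = 1 ↔ (0 < dist (Φ p) (Φ q) ∧ dist (Φ p) (Φ q) ≤ 28 / 25))) → (∀ᵐ μ ∂P, ∀ q : EuclideanSpace ℝ (Fin 3), μ {q} ≠ 0 → ∃ b : ℝ, 9 / 10 ≤ b ∧ b ≤ 1 ∧ ∃ (A : EuclideanSpace ℝ (Fin 3) →ₗᵢ[ℝ]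 EuclideanSpace ℝ (Fin 3)) (s : ℤ → ℤ) (z : ℤ → ℝ), Literature.MathematicalPhysics.StatisticalMechanics.IsHaggSeq s ∧ (∀ m : ℤ, 39 / 50 * b ≤ z (m + 1) - z m ∧ z (m + 1) - z m ≤ 17 / 20 * b) ∧ z 0 = 0 ∧ (∀ y : EuclideanSpace ℝ (Fin 3), dist y q ≤ 4 * b → μ {y} ≠ 0 → ∃ y' : EuclideanSpace ℝ (Fin 3), y' - q ∈ {p | ∃ m i j : ℤ, p = A (((i : ℝ) • Literature.MathematicalPhysics.StatisticalMechanics.triangularVec₁ b) + ((j : ℝ) • Literature.MathematicalPhysics.StatisticalMechanics.triangularVec₂ b) + ((Literature.MathematicalPhysics.StatisticalMechanics.haggLabel s m : ℝ) • Literature.MathematicalPhysics.StatisticalMechanics.barlowOffset b) + (z m • Literature.MathematicalPhysics.StatisticalMechanics.layerNormal 1))} ∧ dist y y' ≤ ν) ∧ (∀ y' : EuclideanSpace ℝ (Fin 3), y' - q ∈ {p | ∃ m i j : ℤ, p = A (((i : ℝ) • Literature.MathematicalPhysics.StatisticalMechanics.triangularVec₁ b) + ((j : ℝ) • Literature.MathematicalPhysics.StatisticalMechanics.triangularVec₂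 b) + ((Literature.MathematicalPhysics.StatisticalMechanics.haggLabel s m : ℝ) • Literature.MathematicalPhysics.StatisticalMechanics.barlowOffset b) + (z m • Literature.MathematicalPhysics.StatisticalMechanics.layerNormal 1))} → dist y' q ≤ 5 * b → ∃ y : EuclideanSpace ℝ (Fin 3), μ {y} ≠ 0 ∧ dist y y' ≤ ν)) → ∀ᵐ μ ∂P, ∀ η : ℝ, 0 < η → ∃ b : ℝ, 9 / 10 ≤ b ∧ b ≤ 1 ∧ ∃ (A : EuclideanSpace ℝ (Fin 3) →ₗᵢ[ℝ] EuclideanSpace ℝ (Fin 3)) (s : ℤ → ℤ) (z : ℤ → ℝ), Literature.MathematicalPhysics.StatisticalMechanics.IsHaggSeq s ∧ (∀ m : ℤ, 39 / 50 * b ≤ z (m + 1) - z m ∧ z (m + 1) - z m ≤ 17 / 20 * b) ∧ z 0 = 0 ∧ (∀ y : EuclideanSpace ℝ (Fin 3), dist y (0 : EuclideanSpace ℝ (Fin 3)) ≤ 4 * b → μ {y} ≠ 0 → ∃ y' : EuclideanSpace ℝ (Fin 3), y' - (0 : EuclideanSpace ℝ (Fin 3)) ∈ {p | ∃ m i j :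 ℤ, p = A (((i : ℝ) • Literature.MathematicalPhysics.StatisticalMechanics.triangularVec₁ b) + ((j : ℝ) • Literature.MathematicalPhysics.StatisticalMechanics.triangularVec₂ b) + ((Literature.MathematicalPhysics.StatisticalMechanics.haggLabel s m : ℝ) • Literature.MathematicalPhysics.StatisticalMechanics.barlowOffset b) + (z m • Literature.MathematicalPhysics.StatisticalMechanics.layerNormal 1))} ∧ dist y y' ≤ η) ∧ (∀ y' : EuclideanSpace ℝ (Fin 3), y' - (0 : EuclideanSpace ℝ (Fin 3)) ∈ {p | ∃ m i j : ℤ, p = A (((i : ℝ) • Literature.MathematicalPhysics.StatisticalMechanics.triangularVec₁ b) + ((j : ℝ) • Literature.MathematicalPhysics.StatisticalMechanics.triangularVec₂ b) + ((Literature.MathematicalPhysics.StatisticalMechanics.haggLabel s m : ℝ) • Literature.MathematicalPhysics.StatisticalMechanics.barlowOffset b) + (z m • Literature.MathematicalPhysics.StatisticalMechanics.layerNormal 1))} → dist y' (0 : EuclideanSpace ℝ (Fin 3)) ≤ 5 * b → ∃ y : EuclideanSpace ℝ (Fin 3), μ {y} ≠ 0 ∧ dist y y' ≤ η)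

/-- matching is monotone in the tolerance (g19 `matchedAt_mono`, verbatim). -/
theorem matchedAt_mono {ν ν' : ℝ} (h : ν ≤ ν') {μ : MeasureTheory.Measure (EuclideanSpace ℝ (Fin 3))} {x : EuclideanSpace ℝ (Fin 3)} (hm : matchedAt ν μ x) : matchedAt ν' μ x := by
  obtain ⟨b, hb1, hb2, A, s, z, hs, hg, hz, h1, h2⟩ := hm
  refine ⟨b, hb1, hb2, A, s, z, hs, hg, hz, fun y hy hyμ => ?_, fun y' hy' hd => ?_⟩
  · obtain ⟨y', hy', hd⟩ := h1 y hy hyμ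
    exact ⟨y', hy', hd.trans h⟩
  · obtain ⟨y, hyμ, hd'⟩ := h2 y' hy' hd
    exact ⟨y, hyμ, hd'.trans h⟩

/-! ## 2. N's structural binders as named predicates on a configuration `μ` (texts verbatim from N) and the door's conclusion -/

/-- (1/16, 9/10, 1)-two-shell cleanliness at every atom (N's binder, verbatim). -/
def IsClean (μ : Measure E3) : Prop :=
  ∀ q : EuclideanSpace ℝ (Fin 3), μ {q} ≠ 0 → Literature.Geometry.DiscreteGeometry.IsTwoShellGoodSet (1 / 16) (9 / 10) 1 {p : EuclideanSpace ℝ (Fin 3) | μ {p} ≠ 0} q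

/-- single-site Nash stationarity (N's binder, verbatim). -/
def IsNash (μ : Measure E3) : Prop :=
  ∀ p : EuclideanSpace ℝ (Fin 3), μ {p} ≠ 0 → ∀ y : EuclideanSpace ℝ (Fin 3), (∀ q : EuclideanSpace ℝ (Fin 3), μ {q} ≠ 0 → q ≠ p → y ≠ q) → ∑' q : {q : EuclideanSpace ℝ (Fin 3) // μ {q} ≠ 0 ∧ q ≠ p}, Literature.MathematicalPhysics.StatisticalMechanics.lennardJones (dist p (q : EuclideanSpace ℝ (Fin 3))) ≤ ∑' q : {q : EuclideanSpace ℝ (Fin 3) // μ {q} ≠ 0 ∧ q ≠ p}, Literature.MathematicalPhysics.StatisticalMechanics.lennardJones (dist y (q : EuclideanSpace ℝ (Fin 3)))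

/-- Barlow-bond-chartedness (N's binder, verbatim). -/
def IsCharted (μ : Measure E3) : Prop :=
  ∃ s : ℤ → ℤ, Literature.MathematicalPhysics.StatisticalMechanics.IsHaggSeq s ∧ ∃ Φ : EuclideanSpace ℝ (Fin 3) → EuclideanSpace ℝ (Fin 3), Set.BijOn Φ (Literature.MathematicalPhysics.StatisticalMechanics.barlowStacking 1 (Real.sqrt (2 / 3)) s) {p : EuclideanSpace ℝ (Fin 3) | μ {p} ≠ 0} ∧ ∀ p ∈ Literature.MathematicalPhysics.StatisticalMechanics.barlowStacking 1 (Real.sqrt (2 / 3)) s, ∀ q ∈ Literature.MathematicalPhysics.StatisticalMechanics.barlowStacking 1 (Real.sqrt (2 / 3)) s, (dist p q = 1 ↔ (0 < dist (Φ p) (Φ q) ∧ dist (Φ p) (Φ q) ≤ 28 / 25))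

/-- `IsEStarGSC μ`: the atom set of `μ` is an e⋆-μ-ground-state configuration of V_LJ, written out — VERBATIM the conclusion of
`Theses.GrainCoreNetworkSplit.MuEquilibriumDoor` (name-free form of Literature `IsMuGSC lennardJones e⋆`). -/
def IsEStarGSC (μ : Measure E3) : Prop :=
  (∀ r : EuclideanSpace ℝ (Fin 3), Summable fun y : ↥({p : EuclideanSpace ℝ (Fin 3) | μ {p} ≠ 0}) => Literature.MathematicalPhysics.StatisticalMechanics.lennardJones (dist r y)) ∧ ∀ (n : ℕ) (xf : Fin n → EuclideanSpace ℝ (Fin 3)), Function.Injective xf → Set.range xf ⊆ {p : EuclideanSpace ℝ (Fin 3) | μ {p} ≠ 0} → ∀ (k : ℕ) (R : Fin k → EuclideanSpace ℝ (Fin 3)), Function.Injective R → Disjoint (Set.range R) ({p : EuclideanSpace ℝ (Fin 3) | μ {p} ≠ 0} \ Set.range xf) → Literature.MathematicalPhysics.StatisticalMechanics.interactionEnergy Literature.MathematicalPhysics.StatisticalMechanics.lennardJones xf + (∑ i, ∑' y : ↥({p : EuclideanSpace ℝ (Fin 3) | μ {p} ≠ 0} \ Set.range xf), Literature.MathematicalPhysics.StatisticalMechanics.lennardJones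 (dist (xf i) y)) - (⨅ Q : Literature.MathematicalPhysics.StatisticalMechanics.PeriodicConfiguration 3, Q.energyPerParticle Literature.MathematicalPhysics.StatisticalMechanics.lennardJones) * n ≤ Literature.MathematicalPhysics.StatisticalMechanics.interactionEnergy Literature.MathematicalPhysics.StatisticalMechanics.lennardJones R + (∑ i, ∑' y : ↥({p : EuclideanSpace ℝ (Fin 3) | μ {p} ≠ 0} \ Set.range xf), Literature.MathematicalPhysics.StatisticalMechanics.lennardJones (dist (R i) y)) - (⨅ Q : Literature.MathematicalPhysics.StatisticalMechanics.PeriodicConfiguration 3, Q.energyPerParticle Literature.MathematicalPhysics.StatisticalMechanics.lennardJones) * k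

/-! ## 3. Window vocabulary: site energy, atoms of a window, unmatched atoms, boundary layer, normalised window bad-fraction -/

/-- site energy of `x` in `μ`: `e_x(μ) = ½ ∫ V_LJ ‖y − x‖ dμ` (= `rootEnergy lennardJones μ` at `x = 0` up to `‖y − 0‖ = ‖y‖`). -/
def siteEnergy (μ : Measure E3) (x : E3) : ℝ :=
  (∫ y, Literature.MathematicalPhysics.StatisticalMechanics.lennardJones ‖y - x‖ ∂μ) / 2

/-- the atoms of `μ` in the closed `R`-window about `x`. -/
def atomsIn (μ : Measure E3) (x : E3) (R : ℝ) : Set E3 :=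
  {p : E3 | μ {p} ≠ 0 ∧ dist p x ≤ R}

/-- the atoms of `K` that are NOT `θ`-matched in `μ`. -/
def badIn (θ : ℝ) (μ : Measure E3) (K : Set E3) : Set E3 :=
  {p : E3 | p ∈ K ∧ ¬ matchedAt θ μ p}

/-- the `r`-boundary layer of `K` in `μ`: atoms of `K` within `r` of an atom of `μ` outside `K`. -/
def bdryIn (r : ℝ) (μ : Measure E3) (K : Set E3) : Set E3 :=
  {p : E3 | p ∈ K ∧ ∃ y : E3, μ {y} ≠ 0 ∧ y ∉ K ∧ dist p y ≤ r}

/-- `windowBadFrac ν R μ = Σ_{p unmatched atom, dist p 0 ≤ R} 1 / #(atoms in B̄_R(p))` — the Mecke-normalised count of `ν`-unmatched atoms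
of the root's `R`-window (its `P`-mean is EXACTLY `P(root not ν-matched)` for a point-stationary rooted law: piece `SparseNull`). -/
def windowBadFrac (ν R : ℝ) (μ : Measure E3) : ℝ :=
  ∑ᶠ p ∈ badIn ν μ (atomsIn μ 0 R), (1 : ℝ) / (Set.ncard (atomsIn μ p R) : ℝ)

/-! ## 4. THE PIECES -/

/-- **R⋆ «DiscreteBarlowRigidity»** — the lineage's shared missing lemma (critic row 341 (5)), typed in deterministic set currency with
e⋆-free constants `c, C, r` depending on the hard core `δ` only.  For every tolerance `0 < θ ≤ 1/16`, every `δ`-separated configuration `S`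
and every FINITE chunk `K ⊆ S` of (1/16, 9/10, 1)-two-shell-clean atoms:
`c·θ²·#{x ∈ K | ¬ matchedAt θ S x} ≤ Σ_{x∈K} (e_x(S) − e⋆) + C·#{x ∈ K | ∃ y ∈ S∖K, dist x y ≤ r}`.
(Energy above e⋆ controls, up to a boundary layer, the number of atoms visibly off EVERY isometric flexible-scale flexible-gap layered Barlow
template; sites matched to a dilated or gap-relaxed template are not charged — those soft directions are U₁'s business.)
Tags: ROOF (STRONGER than SparseMisfit/GAP/PERT — honest), XL, INSTRUMENTABLE, TRUE-type expected (FJM/CDKM/Schmidt–Steinbach analogues). -/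
def DiscreteBarlowRigidity : Prop :=
  ∀ δ : ℝ, 0 < δ → ∃ c : ℝ, 0 < c ∧ ∃ C : ℝ, 0 ≤ C ∧ ∃ r : ℝ, 0 < r ∧ ∀ θ : ℝ, 0 < θ → θ ≤ 1 / 16 →
    ∀ S : Set E3, (∀ x ∈ S, ∀ y ∈ S, x ≠ y → δ ≤ dist x y) → ∀ K : Set E3, K ⊆ S → K.Finite →
    (∀ x ∈ K, Literature.Geometry.DiscreteGeometry.IsTwoShellGoodSet (1 / 16) (9 / 10) 1 S x) →
    c * θ ^ 2 * (Set.ncard (badIn θ ((Measure.count : Measure E3).restrict S) K) : ℝ) ≤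
      (∑ᶠ x ∈ K, (siteEnergy ((Measure.count : Measure E3).restrict S) x - eStar)) +
        C * (Set.ncard (bdryIn r ((Measure.count : Measure E3).restrict S) K) : ℝ)

/-- **BindingSurface** (TRUE·M): in a rooted `δ`-hard-core e⋆-μ-ground state, the site-energy excess of the root's `R`-window is of SURFACE
order: `Σ_{atoms x, dist x 0 ≤ R} (e_x − e⋆) ≤ C₁(δ)·R²` for `R ≥ 1` (removal test k = 0 + `Σ_K e_x = U(K) + ½ I(K, S∖K)` + tail/shell bound). -/
def BindingSurface : Prop :=
  ∀ δ : ℝ, 0 < δ → ∃ C₁ : ℝ, 0 ≤ C₁ ∧ ∀ μ : Measure E3, Literature.Probability.Process.IsRootedHardCore δ μ → IsEStarGSC μ →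
    ∀ R : ℝ, 1 ≤ R → (∑ᶠ x ∈ atomsIn μ 0 R, (siteEnergy μ x - eStar)) ≤ C₁ * R ^ 2

/-- **WindowCounting** (TRUE·S/M): for rooted `δ`-hard-core CLEAN configurations and `R ≥ 1`, the `r`-boundary layer of the root's `R`-window has
`≤ C₂ R²` atoms, and every atom `p` of that window has `≥ c₃ R³` atoms in its own `R`-window (packing + cleanliness ⇒ local density). -/
def WindowCounting : Prop :=
  ∀ δ : ℝ, 0 < δ → ∀ r : ℝ, 0 < r → ∃ C₂ : ℝ, 0 ≤ C₂ ∧ ∃ c₃ : ℝ, 0 < c₃ ∧ ∀ μ : Measure E3,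
    Literature.Probability.Process.IsRootedHardCore δ μ → IsClean μ → ∀ R : ℝ, 1 ≤ R →
    (Set.ncard (bdryIn r μ (atomsIn μ 0 R)) : ℝ) ≤ C₂ * R ^ 2 ∧
      ∀ p : E3, μ {p} ≠ 0 → dist p 0 ≤ R → c₃ * R ^ 3 ≤ (Set.ncard (atomsIn μ p R) : ℝ)

/-- **SparseMisfit(ν) = D♯(ν)** — the residual GAP translated into DETERMINISTIC μ-ground-state currency (WEAKER-OR-EQUIVALENT to GAP(ν) via
configuration→law transfer; UNDECIDED; INSTRUMENTABLE): in every rooted `δ`-hard-core, clean, single-site-Nash, Barlow-bond-charted e⋆-μ-ground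
state the normalised count of `ν`-unmatched atoms of the root's `R`-window is `≤ ε` as soon as `R ≥ R(δ, ε)`. -/
def SparseMisfit (ν : ℝ) : Prop :=
  ∀ δ : ℝ, 0 < δ → ∀ ε : ℝ, 0 < ε → ∃ R : ℝ, 0 < R ∧ ∀ μ : Measure E3, Literature.Probability.Process.IsRootedHardCore δ μ →
    IsClean μ → IsNash μ → IsCharted μ → IsEStarGSC μ → windowBadFrac ν R μ ≤ ε

/-- **SparseNull(ν)** (TRUE·M, the unimodular window identity): for a point-stationary rooted hard-core law,
`E_P[windowBadFrac ν R] = P(root window not ν-matched)` for every `R`; hence uniformly vanishing window bad-fractions force a.s. matching at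
the root.  (Mecke with `g μ y = 𝟙{¬ matchedAt ν μ y}·𝟙{‖y‖ ≤ R}/#(atomsIn μ y R)`, covariance of `matchedAt`, `#(atomsIn (θ_y μ) 0 R) =
#(atomsIn μ y R)`; measurability as in Theorems.ChartedPlanarOrderDefectEventMeasurable.) -/
def SparseNull (ν : ℝ) : Prop :=
  ∀ δ : ℝ, 0 < δ → ∀ P : Measure (Measure E3), IsProbabilityMeasure P → (∀ᵐ μ ∂P, Literature.Probability.Process.IsRootedHardCore δ μ) →
    Literature.Probability.Process.IsPointStationaryLaw P →
    (∀ ε : ℝ, 0 < ε → ∃ R : ℝ, 0 < R ∧ ∀ᵐ μ ∂P, windowBadFrac ν R μ ≤ ε) → ∀ᵐ μ ∂P, matchedAt ν μ 0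

/-- **GapTransfer(ν)** — the CERTIFICATE EDGE of the translation, typed (not used by the kernels; TRUE-type expected, L): the visible-gap
residual at every smaller tolerance implies the deterministic translation, `(∀ ν' < ν, GAP(ν')) ⟹ SparseMisfit(ν)`.  Argument (prose, card §3):
configuration → law transfer — uniform re-rooting of a violating sequence over the root's windows, subsequential local limit (tightness from the
hard core), point-stationarity of the limit, closedness of rooted-hard-core / Nash / charted, `MuGSCLimitClosed` (lens-4 p810240) for e⋆-μGSC,
mean energy ≤ e⋆ from BindingSurface, and Portmanteau on the CLOSED event `closure {¬ matched_ν} ⊆ {¬ matched_ν'}`.  CAVEAT (honest): N's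
cleanliness binder `IsTwoShellGoodSet (1/16) (9/10) 1` has a sharp exclusivity clause (`dist y q ≤ 3/2·a → y is a pattern image`), so the clean
class is closed under local limits only off tolerance-saturated configurations; the edge is UNDECIDED there (test: exhibit a clean sequence with
an unclean local limit inside an e⋆-μGSC violating family — none known). -/
def GapTransfer (ν : ℝ) : Prop :=
  (∀ ν' : ℝ, 0 < ν' → ν' < ν → VisibleGap ν') → SparseMisfit ν

/-- bookkeeping (by definition): with the certificate edge, the GAP family below ν gives the translation at ν. -/
theorem sparseMisfit_of_gapFamily (ν : ℝ) (hT : GapTransfer ν) (hG : ∀ ν' : ℝ, 0 < ν' → ν' < ν → VisibleGap ν') :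
    SparseMisfit ν :=
  hT hG

/-! ## 5. KERNELS (0 sorry) -/

/-- THE DOOR CUT beneath GAP:  DOOR (lens-2 `MuEquilibriumDoor`, by name) ∧ SparseNull(ν) ∧ SparseMisfit(ν) ⟹ GAP(ν). -/
theorem visibleGap_of_door_sparse (ν : ℝ)
    (hD : Summit.AtomisticToContinuum.Crystallization.Theses.GrainCoreNetworkSplit.MuEquilibriumDoor)
    (hN : SparseNull ν) (hS : SparseMisfit ν) : VisibleGap ν := by
  intro δ hδ P hP hroot hmecke hen hclean hnash hchart
  -- the door: a.s. an e⋆-μ-ground state (N's binders ARE the door's hypotheses, by unfolding)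
  have hG : ∀ᵐ μ ∂P, IsEStarGSC μ := hD δ hδ P hP hroot hmecke hen
  -- the deterministic translation, uniformly in the configuration
  have hW : ∀ ε : ℝ, 0 < ε → ∃ R : ℝ, 0 < R ∧ ∀ᵐ μ ∂P, windowBadFrac ν R μ ≤ ε := by
    intro ε hε
    obtain ⟨R, hR, h⟩ := hS δ hδ ε hε
    refine ⟨R, hR, ?_⟩
    filter_upwards [hroot, hclean, hnash, hchart, hG] with μ h1 h2 h3 h4 h5
    exact h μ h1 h2 h3 h4 h5
  -- the unimodular window identity
  exact hN δ hδ P hP hroot hmecke hW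

/-- THE DOOR CUT beneath PERT: the same pieces at every tolerance `η ≤ 1/16` give matching at EVERY tolerance at the root (countably many
tolerances `1/(n+16)` at once, monotonicity of matching); PERT's extra hypothesis «ν-matched about every atom» is not even used. -/
theorem pertRegime_of_door_sparse (ν : ℝ)
    (hD : Summit.AtomisticToContinuum.Crystallization.Theses.GrainCoreNetworkSplit.MuEquilibriumDoor)
    (hN : ∀ η : ℝ, 0 < η → η ≤ 1 / 16 → SparseNull η) (hS : ∀ η : ℝ, 0 < η → η ≤ 1 / 16 → SparseMisfit η) :
    PertRegime ν := by
  intro δ hδ P hP hroot hmecke hen hclean hnash hchart _hall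
  have hG : ∀ᵐ μ ∂P, IsEStarGSC μ := hD δ hδ P hP hroot hmecke hen
  -- matching at each tolerance η_n = 1/(n+16)
  have hη : ∀ n : ℕ, (0 : ℝ) < 1 / ((n : ℝ) + 16) ∧ 1 / ((n : ℝ) + 16) ≤ 1 / 16 := by
    intro n
    refine ⟨by positivity, ?_⟩
    exact one_div_le_one_div_of_le (by norm_num) (by linarith [n.cast_nonneg (α := ℝ)])
  have hn : ∀ n : ℕ, ∀ᵐ μ ∂P, matchedAt (1 / ((n : ℝ) + 16)) μ 0 := by
    intro n
    have hW : ∀ ε : ℝ, 0 < ε → ∃ R : ℝ, 0 < R ∧ ∀ᵐ μ ∂P, windowBadFrac (1 / ((n : ℝ) + 16)) R μ ≤ ε := by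
      intro ε hε
      obtain ⟨R, hR, h⟩ := hS _ (hη n).1 (hη n).2 δ hδ ε hε
      refine ⟨R, hR, ?_⟩
      filter_upwards [hroot, hclean, hnash, hchart, hG] with μ h1 h2 h3 h4 h5
      exact h μ h1 h2 h3 h4 h5
    exact hN _ (hη n).1 (hη n).2 δ hδ P hP hroot hmecke hW
  have hall : ∀ᵐ μ ∂P, ∀ n : ℕ, matchedAt (1 / ((n : ℝ) + 16)) μ 0 := ae_all_iff.2 hn
  filter_upwards [hall] with μ hμ
  intro η hη0
  -- some 1/(n+16) ≤ η
  obtain ⟨n, hnη⟩ := exists_nat_one_div_lt hη0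
  have hle : 1 / ((n : ℝ) + 16) ≤ η := by
    have : 1 / ((n : ℝ) + 16) ≤ 1 / ((n : ℝ) + 1) :=
      one_div_le_one_div_of_le (by positivity) (by linarith)
    exact this.trans hnη.le
  exact matchedAt_mono hle (hμ n)

/-- THE ROOF beneath the translation:  R⋆ ∧ BindingSurface ∧ WindowCounting ⟹ SparseMisfit(ν) for every visible tolerance `0 < ν ≤ 1/16`.
Arithmetic: R⋆ on the chunk K = root's R-window at θ = ν, the μGSC surface bound and the boundary-layer count give
`#unmatched ≤ (C₁ + C·C₂) R² / (c ν²)`; each unmatched atom weighs `≤ 1/(c₃ R³)`; so `windowBadFrac ≤ A/(c₃ R) ≤ ε` for `R` large. -/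
theorem sparseMisfit_of_rigidity {ν : ℝ} (hν : 0 < ν) (hν' : ν ≤ 1 / 16)
    (hR : DiscreteBarlowRigidity) (hB : BindingSurface) (hW : WindowCounting) : SparseMisfit ν := by
  intro δ hδ ε hε
  obtain ⟨c, hc, C, hC, r, hr, hRθ⟩ := hR δ hδ
  obtain ⟨C₁, hC₁, hB'⟩ := hB δ hδ
  obtain ⟨C₂, hC₂, c₃, hc₃, hW'⟩ := hW δ hδ r hr
  -- the constant A and the radius
  set A : ℝ := (C₁ + C * C₂) / (c * ν ^ 2) with hA
  have hA0 : 0 ≤ A := by positivity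
  refine ⟨A / (c₃ * ε) + 1, by positivity, ?_⟩
  intro μ hroot hclean hnash hchart hgsc
  set R : ℝ := A / (c₃ * ε) + 1 with hRdef
  have hR1 : 1 ≤ R := by
    have : 0 ≤ A / (c₃ * ε) := by positivity
    linarith
  have hR0 : 0 < R := by linarith
  obtain ⟨S, h0S, hsep, hμ⟩ := hroot
  -- the chunk K = root's R-window
  have hatom : ∀ p : E3, μ {p} ≠ 0 ↔ p ∈ S := by
    intro p; rw [hμ]; exact Literature.Probability.Process.count_restrict_singleton_ne_zero_iff S p
  have hKS : atomsIn μ 0 R ⊆ S := fun p hp => (hatom p).1 hp.1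
  have hKfin : (atomsIn μ 0 R).Finite := by
    have hf : (Metric.closedBall (0 : E3) R ∩ S).Finite :=
      Literature.Probability.Process.LocalConfig.finite_inter_of_separated hδ hsep (isCompact_closedBall (0 : E3) R)
    refine hf.subset ?_
    intro p hp
    exact ⟨Metric.mem_closedBall.2 hp.2, (hatom p).1 hp.1⟩
  have hKclean : ∀ x ∈ atomsIn μ 0 R, Literature.Geometry.DiscreteGeometry.IsTwoShellGoodSet (1 / 16) (9 / 10) 1 S x := by
    intro x hx
    have h1 := hclean x hx.1
    have hset : {p : EuclideanSpace ℝ (Fin 3) | μ {p} ≠ 0} = S := by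
      ext p; exact hatom p
    rw [hset] at h1
    exact h1
  -- (i) R⋆ on K at θ = ν
  have hstar : c * ν ^ 2 * (Set.ncard (badIn ν μ (atomsIn μ 0 R)) : ℝ) ≤
      (∑ᶠ x ∈ atomsIn μ 0 R, (siteEnergy μ x - eStar)) + C * (Set.ncard (bdryIn r μ (atomsIn μ 0 R)) : ℝ) := by
    have h := hRθ ν hν hν' S hsep (atomsIn μ 0 R) hKS hKfin hKclean
    rw [hμ]
    rw [hμ] at hKS hKfin hKclean
    exact hRθ ν hν hν' S hsep _ hKS hKfin hKclean
  -- (ii) the μGSC surface bound and (iii) the counting bounds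
  have hbind : (∑ᶠ x ∈ atomsIn μ 0 R, (siteEnergy μ x - eStar)) ≤ C₁ * R ^ 2 :=
    hB' μ ⟨S, h0S, hsep, hμ⟩ hgsc R hR1
  obtain ⟨hbd, hdens⟩ := hW' μ ⟨S, h0S, hsep, hμ⟩ hclean R hR1
  -- number of unmatched atoms in the window
  have hbad : (Set.ncard (badIn ν μ (atomsIn μ 0 R)) : ℝ) ≤ A * R ^ 2 := by
    have h1 : c * ν ^ 2 * (Set.ncard (badIn ν μ (atomsIn μ 0 R)) : ℝ) ≤ (C₁ + C * C₂) * R ^ 2 := by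
      have h2 : C * (Set.ncard (bdryIn r μ (atomsIn μ 0 R)) : ℝ) ≤ C * (C₂ * R ^ 2) :=
        mul_le_mul_of_nonneg_left hbd hC
      nlinarith [hstar, hbind, h2]
    have hcν : 0 < c * ν ^ 2 := by positivity
    rw [hA, div_mul_eq_mul_div, le_div_iff₀ hcν]
    nlinarith [h1]
  -- each unmatched atom of the window weighs at most 1/(c₃ R³)
  have hterm : ∀ p ∈ badIn ν μ (atomsIn μ 0 R), (1 : ℝ) / (Set.ncard (atomsIn μ p R) : ℝ) ≤ 1 / (c₃ * R ^ 3) := by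
    intro p hp
    have hp' : p ∈ atomsIn μ 0 R := hp.1
    have hd := hdens p hp'.1 hp'.2
    exact one_div_le_one_div_of_le (by positivity) hd
  have hbadfin : (badIn ν μ (atomsIn μ 0 R)).Finite := hKfin.subset (fun p hp => hp.1)
  have hfrac : windowBadFrac ν R μ ≤ (Set.ncard (badIn ν μ (atomsIn μ 0 R)) : ℝ) * (1 / (c₃ * R ^ 3)) := by
    unfold windowBadFrac
    rw [finsum_mem_eq_finite_toFinset_sum _ hbadfin, Set.ncard_eq_toFinset_card _ hbadfin]
    have hs := Finset.sum_le_card_nsmul hbadfin.toFinset (fun p => (1 : ℝ) / (Set.ncard (atomsIn μ p R) : ℝ)) (1 / (c₃ * R ^ 3))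
      (fun p hp => hterm p (hbadfin.mem_toFinset.1 hp))
    simpa [nsmul_eq_mul] using hs
  -- conclusion
  have hfin : (Set.ncard (badIn ν μ (atomsIn μ 0 R)) : ℝ) * (1 / (c₃ * R ^ 3)) ≤ ε := by
    have hR3 : 0 < c₃ * R ^ 3 := by positivity
    calc (Set.ncard (badIn ν μ (atomsIn μ 0 R)) : ℝ) * (1 / (c₃ * R ^ 3))
        ≤ A * R ^ 2 * (1 / (c₃ * R ^ 3)) := mul_le_mul_of_nonneg_right hbad (by positivity)
      _ = A / (c₃ * R) := by field_simp
      _ ≤ ε := by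
          rw [div_le_iff₀ (by positivity)]
          -- A ≤ ε c₃ R since R ≥ A/(c₃ ε) + 1
          have : A / (c₃ * ε) ≤ R := by linarith
          have h' : A ≤ R * (c₃ * ε) := by rwa [div_le_iff₀ (by positivity)] at this
          nlinarith [h']
  exact hfrac.trans hfin

/-- GAP through the door and the roof: DOOR ∧ SparseNull(ν) ∧ R⋆ ∧ BindingSurface ∧ WindowCounting ⟹ GAP(ν)  (0 < ν ≤ 1/16). -/
theorem visibleGap_of_rigidity {ν : ℝ} (hν : 0 < ν) (hν' : ν ≤ 1 / 16)
    (hD : Summit.AtomisticToContinuum.Crystallization.Theses.GrainCoreNetworkSplit.MuEquilibriumDoor)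
    (hN : SparseNull ν) (hR : DiscreteBarlowRigidity) (hB : BindingSurface) (hW : WindowCounting) : VisibleGap ν :=
  visibleGap_of_door_sparse ν hD hN (sparseMisfit_of_rigidity hν hν' hR hB hW)

/-- PERT through the door and the roof: DOOR ∧ (∀ η ≤ 1/16, SparseNull η) ∧ R⋆ ∧ BindingSurface ∧ WindowCounting ⟹ PERT(ν). -/
theorem pertRegime_of_rigidity (ν : ℝ)
    (hD : Summit.AtomisticToContinuum.Crystallization.Theses.GrainCoreNetworkSplit.MuEquilibriumDoor)
    (hN : ∀ η : ℝ, 0 < η → η ≤ 1 / 16 → SparseNull η) (hR : DiscreteBarlowRigidity) (hB : BindingSurface) (hW : WindowCounting) :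
    PertRegime ν :=
  pertRegime_of_door_sparse ν hD hN (fun _ hη hη' => sparseMisfit_of_rigidity hη hη' hR hB hW)

/-- the two open analytic stubs of the skeleton of record at the dial ν₀ = 1/50, from the door pieces and the roof. -/
theorem gap_and_pert_1_50_of_rigidity
    (hD : Summit.AtomisticToContinuum.Crystallization.Theses.GrainCoreNetworkSplit.MuEquilibriumDoor)
    (hN : ∀ η : ℝ, 0 < η → η ≤ 1 / 16 → SparseNull η) (hR : DiscreteBarlowRigidity) (hB : BindingSurface) (hW : WindowCounting) :
    VisibleGap (1 / 50) ∧ PertRegime (1 / 50) :=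
  ⟨visibleGap_of_rigidity (by norm_num) (by norm_num) hD (hN _ (by norm_num) (by norm_num)) hR hB hW,
    pertRegime_of_rigidity (1 / 50) hD hN hR hB hW⟩

/-- **Bridge to the TEXT OF RECORD** (critic row 353): the node's `DiscreteBarlowRigidity` is, by `rfl`, the def-free expanded text
`ChartedPlanarOrderDiscreteBarlowRigidity.DiscreteBarlowRigidityExpanded` (tree declarations only) that the lineage registers and cites BY NAME. -/
theorem discreteBarlowRigidity_iff_expanded :
    DiscreteBarlowRigidity ↔
      Summit.AtomisticToContinuum.Crystallization.Theorems.ChartedPlanarOrderDiscreteBarlowRigidity.DiscreteBarlowRigidityExpanded :=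
  Iff.rfl

end Summit.AtomisticToContinuum.Crystallization.Theorems.ChartedPlanarOrderRigidityDoor

end
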